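import Mathlib
import HarnessLib
import Summits.ValiantsHypothesis.ValiantsHypothesis.Theorems.KPlusLogSqLawMixedGaugeBiCoordBlockFamily
import Summits.ValiantsHypothesis.ValiantsHypothesis.Theorems.KPlusLogSqLawMixedGaugeFamilyDownwardTwoScale
import Summits.ValiantsHypothesis.ValiantsHypothesis.Theorems.KPlusLogSqLawMixedGaugeCoordAllRatios

/-!
# Route «KPlusLogSqLaw», `WeakLifting` (stmt-ValiantsHypothesis-19561) — mixed-gauge series, SEVERAL FAST SPEEDS WITHIN A FACTOR TWO:
# `det [[A + diag(X^{aᵢ}), B], [Bᵀ, C − diag(X^{b_l})]]` has at most `n + 2m` distinct positive roots when `aᵢ < β < b_l < 2β`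

HONEST FRAMING.  Helper file (hand leafhand-val-kpluslogsqlaw-1 g14, 2026-08-31; `--supports stmt-ValiantsHypothesis-19561 --as helper`,
zero crux / stub credit).  The next cell of lift-p4 g26's GAP NOTE (ii) after the several-slow-speeds law (p835068): `n` slow positive diagonal
monomials of speeds `aᵢ`, `m` fast NEGATIVE diagonal monomials of speeds `b_l`, one constant symmetric letter, with a natural SEPARATING SCALE `β`:
`1 ≤ aᵢ < β < b_l < 2β` (all fast speeds within a factor two of each other and above all slow speeds; a general configuration with
`max a < min b ≤ max b < 2·min b` reduces to this after `x ↦ y⁴`, `β = 4·min b − 1` — not typed here).  LAW (`card_posRoots_det_biCoordBlockPencil_le`):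
at most `n + 2m` distinct positive roots; `Σ_{t>0} dim ker ≤ n + 2m` (`sum_corank_le_biCoordBlocks`).  PROOF: (D) the TWO-SCALE family downward
law `MixedGauge.family_down_card_le_twoScale` (p835170: strict Loewner positivity of `y^{aᵢ/β}` + conditional negativity of `y^{b_l/β}`,
`b_l/β ∈ (1,2)`, p835128) at the nodes `x^β`; (U) the inertia drift (kernel split, one-sided jumps, refined window, end scales of
`…MixedGaugeBiCoordBlockFamily`).  Nothing here is about `WeakLifting` / `TropicalB` in their windows, the registered stubs, the doors,
`MatrixDescartes` (18050) or VP ≠ VNP.  No `def`; axioms standard. [folklore]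
-/

set_option linter.dupNamespace false
set_option autoImplicit false

namespace Summit.ValiantsHypothesis.ValiantsHypothesis.Theorems.KPlusLogSqLaw

namespace MixedGauge

open Matrix Finset Polynomial
open scoped BigOperators Topology
open Summit.ValiantsHypothesis.ValiantsHypothesis.Theorems.LacunarySymmetroidMatrixDescartes
open Summit.ValiantsHypothesis.ValiantsHypothesis.Theorems.LacunarySymmetroidMatrixDescartes.Inertia

variable {n m : ℕ}

/-- **THE VERTEX-GAUGE LAW WITH SEVERAL FAST SPEEDS WITHIN A FACTOR TWO (kernel-dimension form).** [folklore] -/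
theorem sum_corank_le_biCoordBlocks (A : Matrix (Fin n) (Fin n) ℝ) (hA : A.IsSymm) (C : Matrix (Fin m) (Fin m) ℝ) (hC : C.IsSymm)
    (B : Matrix (Fin n) (Fin m) ℝ) (a : Fin n → ℕ) (bv : Fin m → ℕ) (β : ℕ) (hβ : 1 ≤ β) (ha : ∀ i, 1 ≤ a i) (haβ : ∀ i, a i < β)
    (hβb : ∀ l, β < bv l) (hb2 : ∀ l, bv l < 2 * β)
    (T : Finset ℝ) (hTpos : ∀ t ∈ T, 0 < t)
    (hTroot : ∀ t ∈ T, (Matrix.fromBlocks (A + Matrix.diagonal (fun i => t ^ a i)) B Bᵀ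
      (C - Matrix.diagonal (fun l => t ^ bv l))).det = 0)
    (hTall : ∀ t : ℝ, 0 < t → (Matrix.fromBlocks (A + Matrix.diagonal (fun i => t ^ a i)) B Bᵀ
      (C - Matrix.diagonal (fun l => t ^ bv l))).det = 0 → t ∈ T) :
    ∑ t ∈ T, (Fintype.card (Fin n ⊕ Fin m) - (Matrix.fromBlocks (A + Matrix.diagonal (fun i => t ^ a i)) B Bᵀ
      (C - Matrix.diagonal (fun l => t ^ bv l))).rank) ≤ n + 2 * m := by
  classical
  have hb : ∀ l, 1 ≤ bv l := fun l => by have := hβb l; omega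
  -- the family
  set F : ℝ → Matrix (Fin n ⊕ Fin m) (Fin n ⊕ Fin m) ℝ := fun x =>
    Matrix.fromBlocks (A + Matrix.diagonal (fun i => x ^ a i)) B Bᵀ (C - Matrix.diagonal (fun l => x ^ bv l)) with hFdef
  set G : ℝ → ℝ → Matrix (Fin n ⊕ Fin m) (Fin n ⊕ Fin m) ℝ := fun t x =>
    Matrix.fromBlocks (Matrix.diagonal (fun i => ∑ l ∈ range (a i), x ^ l * t ^ (a i - 1 - l))) 0 0
      (-(Matrix.diagonal (fun l' => ∑ l ∈ range (bv l'), x ^ l * t ^ (bv l' - 1 - l)))) with hGdef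
  have hH : ∀ x, (F x).IsHermitian := fun x => isHermitian_of_isSymm (biCoordFamily_isSymm A C B a bv hA hC x)
  have hFc : ∀ i j, Continuous fun x => F x i j := fun i j => biCoordFamily_continuous A C B a bv i j
  have hGc : ∀ t i j, Continuous fun x => G t x i j := fun t i j => biCoordDiffFamily_continuous a bv t i j
  have hFG : ∀ t x, F x = F t + (x - t) • G t x := fun t x => biCoordFamily_firstOrder A C B a bv t x
  have hGt : ∀ t, G t t = Matrix.fromBlocks (Matrix.diagonal (fun i => (a i : ℝ) * t ^ (a i - 1))) 0 0
      (-(Matrix.diagonal (fun l => (bv l : ℝ) * t ^ (bv l - 1)))) := by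
    intro t
    simp only [hGdef, geom_sum₂_self]
  have hGsymm : ∀ t, (G t t).IsSymm := by
    intro t
    rw [hGt]
    exact Matrix.IsSymm.fromBlocks (Matrix.isSymm_diagonal _) (by simp) ((Matrix.isSymm_diagonal _).neg)
  have hsplit : ∀ t : ℝ, ∃ (p q : ℕ) (np : Fin p → Fin n ⊕ Fin m → ℝ) (nn : Fin q → Fin n ⊕ Fin m → ℝ),
      (∀ j, F t *ᵥ np j = 0) ∧ (∀ j, F t *ᵥ nn j = 0) ∧
      (∀ c : Fin p → ℝ, c ≠ 0 → 0 < (∑ j, c j • np j) ⬝ᵥ (G t t *ᵥ ∑ j, c j • np j)) ∧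
      (∀ c : Fin q → ℝ, (∑ j, c j • nn j) ⬝ᵥ (G t t *ᵥ ∑ j, c j • nn j) ≤ 0) ∧
      LinearIndependent ℝ nn ∧ p + q = Fintype.card (Fin n ⊕ Fin m) - (F t).rank :=
    fun t => exists_kernel_split (F t) (G t t) (hGsymm t)
  choose p q np nn hnpker hnnker hnppos hnnnp hnnli hpq using hsplit
  by_cases hTne : T = ∅
  · subst hTne; simp
  have hTne' : T.Nonempty := Finset.nonempty_iff_ne_empty.mpr hTne
  -- the ends
  set ε : ℝ := T.min' hTne' / 2 with hεdef
  have hmin_pos : 0 < T.min' hTne' := hTpos _ (Finset.min'_mem T hTne')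
  have hε : 0 < ε := by rw [hεdef]; linarith
  have hεlt : ∀ t ∈ T, ε < t := by
    intro t ht
    have := Finset.min'_le T t ht
    rw [hεdef]; linarith
  have hεT : ε ∉ T := fun h => lt_irrefl ε (hεlt ε h)
  have hεdet : (F ε).det ≠ 0 := fun h => hεT (hTall ε hε h)
  set X : ℝ := 1 + (∑ i, ∑ j, |A i j|) + (∑ i, ∑ j, |C i j|) + ∑ t ∈ T, |t| with hXdef
  have hSA : 0 ≤ ∑ i, ∑ j, |A i j| := Finset.sum_nonneg fun i _ => Finset.sum_nonneg fun j _ => abs_nonneg _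
  have hSC : 0 ≤ ∑ i, ∑ j, |C i j| := Finset.sum_nonneg fun i _ => Finset.sum_nonneg fun j _ => abs_nonneg _
  have hST : 0 ≤ ∑ t ∈ T, |t| := Finset.sum_nonneg fun t _ => abs_nonneg _
  have hX1 : 1 ≤ X := by rw [hXdef]; linarith
  have hXA : ∑ i, ∑ j, |A i j| < X := by rw [hXdef]; linarith
  have hXC : ∑ i, ∑ j, |C i j| < X := by rw [hXdef]; linarith
  have hXgt : ∀ t ∈ T, t < X := by
    intro t ht
    have h1 : |t| ≤ ∑ t ∈ T, |t| := Finset.single_le_sum (f := fun t => |t|) (fun t _ => abs_nonneg t) ht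
    have h2 : t ≤ |t| := le_abs_self t
    rw [hXdef]; linarith
  have hXdet : (F X).det ≠ 0 := biCoordFamily_det_ne_zero_of_large A C B a bv ha hb X hX1 hXA hXC
  have hεX : ε < X := by
    obtain ⟨t, ht⟩ := hTne'
    exact lt_trans (hεlt t ht) (hXgt t ht)
  have hTwin : ∀ x ∈ Set.Icc ε X, (F x).det = 0 → x ∈ T := fun x hx hdet => hTall x (lt_of_lt_of_le hε hx.1) hdet
  have hfilter : T.filter (fun t => ε < t ∧ t < X) = T := by
    ext t
    simp only [Finset.mem_filter, and_iff_left_iff_imp]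
    exact fun ht => ⟨hεlt t ht, hXgt t ht⟩
  have hjl : ∀ t ∈ T, ε < t → t < X → ∀ᶠ x in 𝓝[<] t,
      Fintype.card {j // (hH t).eigenvalues j < 0} + p t ≤ Fintype.card {j // (hH x).eigenvalues j < 0} := by
    intro t _ _ _
    have h := eventually_negIndex_ge_add_left F (G t) t (hGc t) (hFG t) hH (np t) (hnpker t) (hnppos t)
    refine h.mono fun x hx => ?_
    rwa [Fintype.card_fin] at hx
  have hjr : ∀ t ∈ T, ε < t → t < X → ∀ᶠ x in 𝓝[>] t,
      Fintype.card {j // (hH x).eigenvalues j < 0} + p t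
        ≤ Fintype.card {j // (hH t).eigenvalues j < 0} + (Fintype.card (Fin n ⊕ Fin m) - (F t).rank) := by
    intro t _ _ _
    have h := eventually_negIndex_add_le_right_of_posFamily F (G t) t (hGc t) (hFG t) hH (np t) (hnpker t) (hnppos t)
    refine h.mono fun x hx => ?_
    rwa [Fintype.card_fin] at hx
  have hwin := negIndex_refined_window F hFc hH T p (fun t => Fintype.card (Fin n ⊕ Fin m) - (F t).rank)
    hεX hTwin hεdet hXdet hjr hjl
  rw [hfilter] at hwin
  have hνX : m ≤ Fintype.card {j // (hH X).eigenvalues j < 0} :=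
    biCoordFamily_negIndex_ge_of_large A C B a bv hA hC hb X hX1 hXC
  have hνε : Fintype.card {j // (hH ε).eigenvalues j < 0} ≤ n + m := by
    have := Fintype.card_subtype_le (fun j => (hH ε).eigenvalues j < 0)
    simpa [Fintype.card_sum, Fintype.card_fin] using this
  -- the two-scale family downward law at the nodes x^β
  set e : Fin T.card ≃ T := (T.equivFin).symm with hedef
  set x : Fin T.card → ℝ := fun s => (e s : ℝ) with hxdef
  have hxpos : ∀ s, 0 < x s := fun s => hTpos _ (e s).2
  have hxinj : Function.Injective x := by
    intro s s' h
    exact e.injective (Subtype.ext h)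
  set pe : Fin n → ℝ := fun i => (a i : ℝ) / β with hpedef
  set ρ : Fin m → ℝ := fun l => ((bv l - β : ℕ) : ℝ) / β with hρdef
  have hpe : ∀ i, pe i ∈ Set.Ioo (0 : ℝ) 1 := by
    intro i
    have hβpos : (0 : ℝ) < β := by exact_mod_cast (show 0 < β by have := haβ i; omega)
    refine ⟨div_pos (by exact_mod_cast (show 0 < a i by have := ha i; omega)) hβpos, ?_⟩
    rw [hpedef, div_lt_one hβpos]
    exact_mod_cast haβ i
  have hρ : ∀ l, ρ l ∈ Set.Ioo (0 : ℝ) 1 := by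
    intro l
    have hβpos : (0 : ℝ) < β := by exact_mod_cast (show 0 < β by have := hβb l; have := hb2 l; omega)
    refine ⟨div_pos (by exact_mod_cast (show 0 < bv l - β by have := hβb l; omega)) hβpos, ?_⟩
    rw [hρdef, div_lt_one hβpos]
    exact_mod_cast (show bv l - β < β by have := hb2 l; omega)
  have hYp : ∀ s i, (x s ^ β) ^ pe i = x s ^ a i := fun s i => by
    have hβ0 : β ≠ 0 := by have := haβ i; omega
    rw [hpedef, TowerGraft.TwoSidedThree.Loewner.pow_rpow_div_natCast (hxpos s) (a i) β hβ0]
  have hYp1 : ∀ s i, pe i * (x s ^ β) ^ (pe i - 1) = (a i : ℝ) / β * (x s ^ a i / x s ^ β) := fun s i => by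
    have hβ0 : β ≠ 0 := by have := haβ i; omega
    rw [hpedef, TowerGraft.TwoSidedThree.Loewner.pow_rpow_div_natCast_sub_one (hxpos s) (a i) β hβ0]
  have hYρ : ∀ s l, (x s ^ β) ^ ρ l = x s ^ (bv l - β) := fun s l => by
    have hβ0 : β ≠ 0 := by have := hβb l; have := hb2 l; omega
    rw [hρdef, TowerGraft.TwoSidedThree.Loewner.pow_rpow_div_natCast (hxpos s) (bv l - β) β hβ0]
  have hYYρ : ∀ s l, x s ^ β * (x s ^ β) ^ ρ l = x s ^ bv l := fun s l => by
    rw [hYρ, ← pow_add]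
    congr 1
    have := hβb l; omega
  have hdown_total : Fintype.card (Σ s : Fin T.card, Fin (q (x s))) ≤ m := by
    refine family_down_card_le_twoScale (n := n) (m := m) pe hpe ρ hρ (fun s => x s ^ β) (fun s => pow_pos (hxpos s) β) ?_
      Sigma.fst (fun j => fun i => nn (x j.1) j.2 (Sum.inl i)) (fun j => fun i => nn (x j.1) j.2 (Sum.inr i)) ?_ ?_ ?_
    · intro s s' h
      have hβ0 : β ≠ 0 := by omega
      exact hxinj ((pow_left_inj₀ (hxpos s).le (hxpos s').le hβ0).mp h)
    · intro j j' hjj'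
      simp only [hYp, hYYρ]
      have hk := hnnker (x j.1) j.2
      have hk' := hnnker (x j'.1) j'.2
      have hsv : ∀ (s : Fin T.card) (i : Fin (q (x s))), nn (x s) i
          = Sum.elim (fun l => nn (x s) i (Sum.inl l)) (fun l => nn (x s) i (Sum.inr l)) := by
        intro s i; funext l; rcases l with l | l <;> rfl
      rw [hsv] at hk hk'
      simp only [hFdef, Matrix.fromBlocks_mulVec] at hk hk'
      have hk1 : (A + Matrix.diagonal (fun i => x j.1 ^ a i)) *ᵥ (fun l => nn (x j.1) j.2 (Sum.inl l))
          + B *ᵥ (fun l => nn (x j.1) j.2 (Sum.inr l)) = 0 := by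
        funext i; have := congrFun hk (Sum.inl i); simpa using this
      have hk2 : Bᵀ *ᵥ (fun l => nn (x j.1) j.2 (Sum.inl l))
          + (C - Matrix.diagonal (fun l => x j.1 ^ bv l)) *ᵥ (fun l => nn (x j.1) j.2 (Sum.inr l)) = 0 := by
        funext i; have := congrFun hk (Sum.inr i); simpa using this
      have hk1' : (A + Matrix.diagonal (fun i => x j'.1 ^ a i)) *ᵥ (fun l => nn (x j'.1) j'.2 (Sum.inl l))
          + B *ᵥ (fun l => nn (x j'.1) j'.2 (Sum.inr l)) = 0 := by
        funext i; have := congrFun hk' (Sum.inl i); simpa using this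
      have hk2' : Bᵀ *ᵥ (fun l => nn (x j'.1) j'.2 (Sum.inl l))
          + (C - Matrix.diagonal (fun l => x j'.1 ^ bv l)) *ᵥ (fun l => nn (x j'.1) j'.2 (Sum.inr l)) = 0 := by
        funext i; have := congrFun hk' (Sum.inr i); simpa using this
      exact biCoord_two_point_blocks A hA C hC B (fun i => x j.1 ^ a i) (fun i => x j'.1 ^ a i)
        (fun l => x j.1 ^ bv l) (fun l => x j'.1 ^ bv l) _ _ _ _ hk1 hk2 hk1' hk2'
    · intro s c
      rw [sum_filter_sigma_fst, sum_filter_sigma_fst]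
      have hform := hnnnp (x s) (fun i => c ⟨s, i⟩)
      set U : Fin n ⊕ Fin m → ℝ := ∑ i, c ⟨s, i⟩ • nn (x s) i with hUdef
      have hUw : (fun i => U (Sum.inl i)) = ∑ i : Fin (q (x s)), c ⟨s, i⟩ • fun l => nn (x s) i (Sum.inl l) := by
        funext l; simp [hUdef, Finset.sum_apply]
      have hUq : (fun i => U (Sum.inr i)) = ∑ i : Fin (q (x s)), c ⟨s, i⟩ • fun l => nn (x s) i (Sum.inr l) := by
        funext l; simp [hUdef, Finset.sum_apply]
      have hUsplit : U = Sum.elim (fun i => U (Sum.inl i)) (fun i => U (Sum.inr i)) := by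
        funext l; rcases l with l | l <;> rfl
      rw [hUsplit, hGt, form_biCoordDiagBlocks] at hform
      rw [← hUw, ← hUq]
      have hxs := hxpos s
      set κ : ℝ := x s / ((β : ℝ) * x s ^ β) with hκ
      have hβpos : (0 : ℝ) < β := by exact_mod_cast (show 0 < β by omega)
      have hκpos : 0 < κ := by rw [hκ]; positivity
      have hcoefS : ∀ i, pe i * (x s ^ β) ^ (pe i - 1) = κ * ((a i : ℝ) * x s ^ (a i - 1)) := by
        intro i
        rw [hYp1, hκ]
        have hpa : x s ^ a i = x s * x s ^ (a i - 1) := by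
          rw [← pow_succ']; congr 1; have := ha i; omega
        rw [hpa]
        field_simp
      have hcoefF : ∀ l, (1 + ρ l) * (x s ^ β) ^ ρ l = κ * ((bv l : ℝ) * x s ^ (bv l - 1)) := by
        intro l
        rw [hYρ, hκ]
        have hcast : ((bv l - β : ℕ) : ℝ) = (bv l : ℝ) - β := by
          rw [Nat.cast_sub (le_of_lt (hβb l))]
        have hρl : 1 + ρ l = (bv l : ℝ) / β := by
          rw [hρdef]; simp only []; rw [hcast]; field_simp; ring
        rw [hρl]
        have hp1 : x s ^ bv l = x s ^ (bv l - β) * x s ^ β := by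
          rw [← pow_add]; congr 1; have := hβb l; omega
        have hp2 : x s ^ bv l = x s * x s ^ (bv l - 1) := by
          rw [← pow_succ']; congr 1; have := hb l; omega
        have hxβ : x s ^ β ≠ 0 := pow_ne_zero _ (ne_of_gt hxs)
        -- (bv/β) x^{bv−β} = (x/(β x^β)) · bv · x^{bv−1}  ⟸  x^{bv−β}·x^β = x·x^{bv−1}
        have key : x s ^ (bv l - β) * x s ^ β = x s * x s ^ (bv l - 1) := by rw [← hp1, hp2]
        field_simp
        linear_combination ((bv l : ℝ)) * key
      calc ∑ i, pe i * (x s ^ β) ^ (pe i - 1) * (U (Sum.inl i)) ^ 2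
          = κ * ∑ i, (a i : ℝ) * x s ^ (a i - 1) * (U (Sum.inl i)) ^ 2 := by
            rw [Finset.mul_sum]
            refine Finset.sum_congr rfl fun i _ => ?_
            rw [hcoefS i]; ring
        _ ≤ κ * ∑ l, (bv l : ℝ) * x s ^ (bv l - 1) * (U (Sum.inr l)) ^ 2 := by
            refine mul_le_mul_of_nonneg_left ?_ hκpos.le
            linarith [hform]
        _ = ∑ l, (1 + ρ l) * (x s ^ β) ^ ρ l * (U (Sum.inr l)) ^ 2 := by
            rw [Finset.mul_sum]
            refine Finset.sum_congr rfl fun l _ => ?_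
            rw [hcoefF l]; ring
    · intro c hw hq
      funext j
      obtain ⟨s, i⟩ := j
      have hw' := hw s
      have hq' := hq s
      rw [sum_filter_sigma_fst] at hw' hq'
      have hU0 : ∑ i : Fin (q (x s)), c ⟨s, i⟩ • nn (x s) i = 0 := by
        funext l
        rcases l with l | l
        · have := congrFun hw' l
          simpa [Finset.sum_apply] using this
        · have := congrFun hq' l
          simpa [Finset.sum_apply] using this
      exact Fintype.linearIndependent_iff.1 (hnnli (x s)) (fun i => c ⟨s, i⟩) hU0 i
  have hsumq : ∑ t ∈ T, q t = Fintype.card (Σ s : Fin T.card, Fin (q (x s))) := by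
    rw [Fintype.card_sigma, ← Finset.sum_coe_sort T]
    simp only [Fintype.card_fin]
    exact Fintype.sum_equiv e.symm (fun t : T => q (t : ℝ)) (fun s => q (x s)) (fun t => by simp [hxdef])
  have hcorank : ∀ t ∈ T, Fintype.card (Fin n ⊕ Fin m) - (F t).rank = p t + q t := fun t _ => (hpq t).symm
  have hsplit_sum : ∑ t ∈ T, (Fintype.card (Fin n ⊕ Fin m) - (F t).rank) = ∑ t ∈ T, p t + ∑ t ∈ T, q t := by
    rw [← Finset.sum_add_distrib]
    exact Finset.sum_congr rfl hcorank
  have hq_le : ∑ t ∈ T, q t ≤ m := by rw [hsumq]; exact hdown_total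
  rw [hsplit_sum] at hwin ⊢
  omega

/-- evaluation of the doubly-diagonal block pencil at a real point. [folklore] -/
theorem eval_biCoordBlockPencil (A : Matrix (Fin n) (Fin n) ℝ) (C : Matrix (Fin m) (Fin m) ℝ) (B : Matrix (Fin n) (Fin m) ℝ)
    (a : Fin n → ℕ) (bv : Fin m → ℕ) (x : ℝ) :
    (Polynomial.evalRingHom x).mapMatrix
        (Matrix.fromBlocks (A.map Polynomial.C + Matrix.diagonal (fun i => (Polynomial.X : Polynomial ℝ) ^ a i)) (B.map Polynomial.C)
          (Bᵀ.map Polynomial.C) (C.map Polynomial.C - Matrix.diagonal (fun l => (Polynomial.X : Polynomial ℝ) ^ bv l))) =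
      Matrix.fromBlocks (A + Matrix.diagonal (fun i => x ^ a i)) B Bᵀ
        (C - Matrix.diagonal (fun l => x ^ bv l)) := by
  rw [RingHom.mapMatrix_apply, Matrix.fromBlocks_map]
  congr 1
  · ext i j
    by_cases hij : i = j
    · subst hij; simp
    · simp [Matrix.diagonal_apply_ne _ hij]
  · ext i j
    simp
  · ext i j
    simp
  · ext i j
    by_cases hij : i = j
    · subst hij; simp
    · simp [Matrix.diagonal_apply_ne _ hij]

/-- **THE VERTEX-GAUGE LAW WITH SEVERAL FAST SPEEDS WITHIN A FACTOR TWO, determinant currency.**  For `A ∈ Sym(n)`, `C ∈ Sym(m)`, any `B`,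
natural speeds with a separating scale `β` (`1 ≤ aᵢ < β < b_l < 2β`): the determinant of `[[A + diag(X^{aᵢ}), B], [Bᵀ, C − diag(X^{b_l})]]`
has at most `n + 2m` distinct positive real roots. [folklore] -/
theorem card_posRoots_det_biCoordBlockPencil_le (A : Matrix (Fin n) (Fin n) ℝ) (hA : A.IsSymm) (C : Matrix (Fin m) (Fin m) ℝ)
    (hC : C.IsSymm) (B : Matrix (Fin n) (Fin m) ℝ) (a : Fin n → ℕ) (bv : Fin m → ℕ) (β : ℕ) (hβ : 1 ≤ β) (ha : ∀ i, 1 ≤ a i)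
    (haβ : ∀ i, a i < β) (hβb : ∀ l, β < bv l) (hb2 : ∀ l, bv l < 2 * β) :
    ((Matrix.det (Matrix.fromBlocks (A.map Polynomial.C + Matrix.diagonal (fun i => (Polynomial.X : Polynomial ℝ) ^ a i))
          (B.map Polynomial.C) (Bᵀ.map Polynomial.C)
          (C.map Polynomial.C - Matrix.diagonal (fun l => (Polynomial.X : Polynomial ℝ) ^ bv l)))).roots.toFinset.filter
        (fun x => 0 < x)).card ≤ n + 2 * m := by
  classical
  have hb : ∀ l, 1 ≤ bv l := fun l => by have := hβb l; omega
  set P := Matrix.det (Matrix.fromBlocks (A.map Polynomial.C + Matrix.diagonal (fun i => (Polynomial.X : Polynomial ℝ) ^ a i))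
          (B.map Polynomial.C) (Bᵀ.map Polynomial.C)
          (C.map Polynomial.C - Matrix.diagonal (fun l => (Polynomial.X : Polynomial ℝ) ^ bv l))) with hPdef
  have heval : ∀ x : ℝ, P.eval x = (Matrix.fromBlocks (A + Matrix.diagonal (fun i => x ^ a i)) B Bᵀ
      (C - Matrix.diagonal (fun l => x ^ bv l))).det := by
    intro x
    rw [hPdef, ← Polynomial.coe_evalRingHom, RingHom.map_det, eval_biCoordBlockPencil]
  set X₀ : ℝ := 1 + (∑ i, ∑ j, |A i j|) + (∑ i, ∑ j, |C i j|) with hX₀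
  have hSA : 0 ≤ ∑ i, ∑ j, |A i j| := Finset.sum_nonneg fun i _ => Finset.sum_nonneg fun j _ => abs_nonneg _
  have hSC : 0 ≤ ∑ i, ∑ j, |C i j| := Finset.sum_nonneg fun i _ => Finset.sum_nonneg fun j _ => abs_nonneg _
  have hP0 : P ≠ 0 := by
    intro h0
    have h1 := heval X₀
    rw [h0, Polynomial.eval_zero] at h1
    exact biCoordFamily_det_ne_zero_of_large A C B a bv ha hb X₀ (by rw [hX₀]; linarith) (by rw [hX₀]; linarith)
      (by rw [hX₀]; linarith) h1.symm
  set T := P.roots.toFinset.filter (fun x => 0 < x) with hTdef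
  have hTpos : ∀ t ∈ T, 0 < t := fun t ht => (Finset.mem_filter.mp ht).2
  have hTroot : ∀ t ∈ T, (Matrix.fromBlocks (A + Matrix.diagonal (fun i => t ^ a i)) B Bᵀ
      (C - Matrix.diagonal (fun l => t ^ bv l))).det = 0 := by
    intro t ht
    have h := (Finset.mem_filter.mp ht).1
    rw [Multiset.mem_toFinset, Polynomial.mem_roots hP0, Polynomial.IsRoot.def, heval] at h
    exact h
  have hTall : ∀ t : ℝ, 0 < t → (Matrix.fromBlocks (A + Matrix.diagonal (fun i => t ^ a i)) B Bᵀ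
      (C - Matrix.diagonal (fun l => t ^ bv l))).det = 0 → t ∈ T := by
    intro t ht hdet
    rw [hTdef, Finset.mem_filter, Multiset.mem_toFinset, Polynomial.mem_roots hP0, Polynomial.IsRoot.def, heval]
    exact ⟨hdet, ht⟩
  have hmain := sum_corank_le_biCoordBlocks A hA C hC B a bv β hβ ha haβ hβb hb2 T hTpos hTroot hTall
  have hge : ∀ t ∈ T, 1 ≤ Fintype.card (Fin n ⊕ Fin m) - (Matrix.fromBlocks (A + Matrix.diagonal (fun i => t ^ a i)) B Bᵀ
      (C - Matrix.diagonal (fun l => t ^ bv l))).rank := by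
    intro t ht
    have := rank_lt_card_of_det_eq_zero _ (hTroot t ht)
    omega
  have hcard : T.card ≤ ∑ t ∈ T, (Fintype.card (Fin n ⊕ Fin m) - (Matrix.fromBlocks (A + Matrix.diagonal (fun i => t ^ a i)) B Bᵀ
      (C - Matrix.diagonal (fun l => t ^ bv l))).rank) := by
    rw [Finset.card_eq_sum_ones]
    exact Finset.sum_le_sum hge
  exact le_trans hcard hmain

end MixedGauge

end Summit.ValiantsHypothesis.ValiantsHypothesis.Theorems.KPlusLogSqLaw
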